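import Summits.RiemannHypothesis.RiemannHypothesis.Theses.WeilSemilocal
import Summits.RiemannHypothesis.RiemannHypothesis.Theorems.SemilocalClassLaw
import Summits.RiemannHypothesis.RiemannHypothesis.Theorems.WeilSemilocalRowsHeadTheta
import Summits.RiemannHypothesis.RiemannHypothesis.Theorems.SemilocalNegCertUptoHundredThreeKinkedFinal
import HarnessLib

/-!
# Route `WeilSemilocal`, item `SemilocalRowsToOneFiftySeven` (stmt-RiemannHypothesis-19396): the fourteen rows `80 ≤ q < 157` REDUCED TO THE THREE LOWER TWINS (RH-FREE)

Cell `rh-explicit`, WEIL column (LADDER-RH W-P(P2)); seat weil-1 gen20. Self-contained companion of `WeilSemilocalRowsToOneFiftySevenOfSix`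
(p444312): of the fourteen primes `80 ≤ q < 157`, the TEN of gap `≥ 4` (83, 89, 97, 103, 109, 113, 127, 131, 139, 151) are tier-1 theta
rows (`WeilSemilocalRowsHeadTheta.thetaHead_walls`, p442040), the lower twin 107 is the kinked K-cell wall
`SemilocalPolyWitness.weilSemilocalThreshold_uptoHundredThree_lt_log_hundrednine_half`, and the three lower twins 101, 137, 149 are
the hypotheses: **`semilocalRowsToOneFiftySeven_of_twins : SemilocalClassLawAt 101 → SemilocalClassLawAt 137 → SemilocalClassLawAt 149 →
SemilocalRowsToOneFiftySeven`** (their K-cell chains `…NinetySevenKinked*` (Final staged), `…HundredThirtyOneKinked*`, `…HundredThirtyNineKinked*`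
are cc-s2-10's). Upper clauses of TRUNCATED Weil forms only; nothing here bears on the truth of RH.
-/

set_option linter.dupNamespace false  -- the mandated namespace repeats `RiemannHypothesis`

namespace Summit.RiemannHypothesis.RiemannHypothesis.Theorems.WeilSemilocalRoute

open Summit.RiemannHypothesis.RiemannHypothesis.Theorems.SemilocalClassLaw
open Summit.RiemannHypothesis.RiemannHypothesis.Theorems.SemilocalPolyWitness

set_option maxRecDepth 8000 in
set_option maxHeartbeats 800000 in  -- 77-way `interval_cases` on `80 ≤ q < 157`
/-- **`SemilocalRowsToOneFiftySeven` MODULO THE THREE LOWER TWINS**: C-I(a) at `q = 101`, `137`, `149` implies the item — the ten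
gap-`≥ 4` rows by tier-1 theta certificates, `q = 107` by its kinked K-cell wall. [this cell; RH-FREE] -/
theorem semilocalRowsToOneFiftySeven_of_twins (h101 : SemilocalClassLawAt 101) (h137 : SemilocalClassLawAt 137)
    (h149 : SemilocalClassLawAt 149) :
    Summit.RiemannHypothesis.RiemannHypothesis.Theses.WeilSemilocal.SemilocalRowsToOneFiftySeven := by
  have h107 : SemilocalClassLawAt 107 :=
    semilocalClassLawAt_of_eq (Q := 109) (by decide) (fun m h1 h2 ↦ by interval_cases m; decide)
      weilSemilocalThreshold_uptoHundredThree_lt_log_hundrednine_half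
  have hθ := thetaHead_walls
  unfold Theses.WeilSemilocal.SemilocalRowsToOneFiftySeven
  intro q hq h80 h157
  interval_cases q <;> first
    | exact absurd hq (by decide)
    | exact hθ _ (by decide)
    | exact h101 | exact h107 | exact h137 | exact h149

end Summit.RiemannHypothesis.RiemannHypothesis.Theorems.WeilSemilocalRoute
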